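import Summits.ResolutionOfSingularities.ResolutionOfSingularities.Theorems.PurelyInseparableDim4E2OfCJSRows
import Summits.ResolutionOfSingularities.ResolutionOfSingularities.Theorems.PurelyInseparableDim4E2DirectrixRow
import Summits.ResolutionOfSingularities.ResolutionOfSingularities.Theorems.PurelyInseparableDim4E2NearPresentation
import HarnessLib

/-!
# The p-PROGRAM (WORD #66): the E2 transfer rows TYPED FOR EVERY PRIME `p` — interface, the five row `Prop`s,
# the `p = 3` adapters, the rows already discharged by p-generic content ((N_p), (E_p)), and the composition
# to the algebraically-closed transfer row + the consumption of CJS Thm. 6.40 (cell `res-dim4-pi`)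

[OURS · counted 0 · AI work weaker than expert review.]  Cell `res-dim4-pi` (D-0157 DOOR 2), seat `res-dim4-p-3` g2
(typist of this interface by desk WORD #66 default (i)); holder of the p-program and of the final assembly
`noWideTrap_of_KeyTheorem640 (p) (hp : 3 ≤ p)`: res-dim4-p-2 g2; row hands: (I_p), (M-c_p) res-dim4-p-11 g2, (M-b_p)
res-dim4-p-7 g2, (X_p) res-dim4-p-2 g2; K res-dim4-p-9 g2 / p-1 g2.  NOTHING here proves the open rows, `NoWideTrap p p`,
the Cossart–Jannsen–Saito theorem, or resolution of singularities in dimension ≥ 4 / characteristic `p`.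

The p = 3 dictionary (`…E2OfCJSRows` p663940 … `…E2OfCJSFinal` p669181: F4-I(3,3) ⟸ CJS Thm 6.40 (F-111) alone) is
typed with the literal `3` (`hypSheaf 3`, `[CharP L 3]`, `ordZero F = 3`, `IsIsolated 3`), but its CONTENT is
p-generic except where CJS's standing assumption (F1) «char k(x) ≥ dim X/2 + 1» enters — for our 4-folds that is
`p ≥ 3`, every prime but `2`.  This file is the p-typed interface:

* §1 `HypStalkP p L F` (`𝒪_{𝔸⁵_L,0} ⧸ (z^p + F)_0`), `PresentedByP p L F S s`; at `p = 3` these ARE `HypStalk` /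
  `PresentedBy` (`rfl`).
* §2 the five row `Prop`s `NearRowP p`, `DirectrixRowP p`, `IsolationRowP p`, `SettingRowP p`, `ModelRowP p` and the
  target `IsolatedConeTwoChainLocalizesAlgClosedP p` — the p = 3 texts with `3 ↦ p` and nothing else (level bound
  `5 ≤ N` = dim + 1 unchanged); untagged parameterised `Prop`s, NOT asserted (OURS rows, not statements of [CJS 2020]).
* §3 **(N_p) and (E_p) DISCHARGED for every prime p** — their content lemmas are already p-generic in the tree:
  `E2Near.hsFun_eq_of_stalk_iso_hypStalk (p)` (res-dim4-p-1 g2, p664524) and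
  `E2Directrix.dirDim_eq_ebar_of_stalk_iso_hypStalk (p)` (p-1 g2 p666993 ∘ res-dim4-p-5 g2 `RidgeDirectrix` p665129).
* §4 the COMPOSITION `isolatedConeTwoChainLocalizesAlgClosedP_of_rows` (bookkeeping, verbatim from p-2 g2's p = 3
  composition) and `no_coneTwo_chain_of_CJS_algClosedP` — CJS Thm. 6.40 (`KeyTheorem640_char_localized_isolated`,
  F-111, via W4.2 `LocalChains.false_of_units_chain`, dimension/characteristic-free) forbids every isolated `ē ≡ 2`
  floor chain over an algebraically closed field of characteristic `p` GIVEN the five rows at `p`.  What remains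
  for `NoWideTrap p p ⟸ F-111` (holder p-2 g2): (I_p), (X_p) (where `p ≥ 3` is used: `CharHypothesis`), (M_p), and
  the base change of WIDE chains to algebraically closed fields.

bears_on: LADDER-RESOLUTION:D157-DOOR2 (res-dim4-pi · F4-I(p,p) ⟸ F-111 ∧ K2(p)).  Supports
stmt-ResolutionOfSingularities-16155 (helper).
-/

set_option linter.dupNamespace false -- mandated namespace of this single-conjunct summit

noncomputable section

open CategoryTheory AlgebraicGeometry TopologicalSpace IsLocalRing
open Literature.AlgebraicGeometry.Resolution Literature.RingTheory.HilbertSamuel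
open Literature.AlgebraicGeometry.Resolution.Hauser2010
open Literature.AlgebraicGeometry.CossartJannsenSaito2020
open Literature.AlgebraicGeometry.Resolution.AffinePointBlowup (P ξ)
open Scheme.IdealSheafData

namespace Summit.ResolutionOfSingularities.ResolutionOfSingularities.Theorems.PIDim4

namespace E2OfCJS

open RidgeBudget (ebar)
open SigmaMaxModificationsCorridor3.Moving.LocalChains (false_of_units_chain)

/-! ## §1 The interface at a prime `p` -/

/-- [OURS] **The local ring of the hypersurface `z^p + F = 0` at the origin of `𝔸⁵_L`**:
`𝒪_{𝔸⁵_L, 0} ⧸ (z^p + F)_0`. [folklore] -/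
def HypStalkP (p : ℕ) (L : Type) [Field L] (F : MvPolynomial (Fin 4) L) : CommRingCat.{0} :=
  CommRingCat.of ((P 4 L).presheaf.stalk (ξ 4 L) ⧸ stalkIdeal (hypSheaf p F) (ξ 4 L))

/-- [OURS] **«`(S, s)` is presented by `F` at the prime `p`»**: `𝒪_{S,s} ≅ 𝒪_{𝔸⁵_L,0} ⧸ (z^p + F)_0`. [folklore] -/
def PresentedByP (p : ℕ) (L : Type) [Field L] (F : MvPolynomial (Fin 4) L) (S : Scheme.{0}) (s : S) : Prop :=
  Nonempty (S.presheaf.stalk s ≅ HypStalkP p L F)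

/-- At `p = 3` the p-interface IS the landed interface. [OURS · adapter] [folklore] -/
theorem hypStalkP_three (L : Type) [Field L] (F : MvPolynomial (Fin 4) L) : HypStalkP 3 L F = HypStalk L F := rfl

/-- At `p = 3` the p-interface IS the landed interface. [OURS · adapter] [folklore] -/
theorem presentedByP_three_iff (L : Type) [Field L] (F : MvPolynomial (Fin 4) L) (S : Scheme.{0}) (s : S) :
    PresentedByP 3 L F S s ↔ PresentedBy L F S s := Iff.rfl

/-! ## §2 The five rows and the target at a prime `p` (OURS, untagged parameterised `Prop`s; not asserted) -/

/-- [OURS · row (N_p) NEAR] Two points presented over the same PERFECT field of characteristic `p` by residual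
polynomials of order EXACTLY `p` have the same Hilbert–Samuel function at every level. (Row `Prop`; see
`nearRowP` for its discharge.) -/
def NearRowP (p : ℕ) : Prop :=
  ∀ (L : Type) [Field L] [CharP L p] [PerfectField L] (F G : MvPolynomial (Fin 4) L),
    ordZero F = (p : ℕ∞) → ordZero G = (p : ℕ∞) →
    ∀ (X : Scheme.{0}) [IsLocallyNoetherian X] (x : X) (Y : Scheme.{0}) [IsLocallyNoetherian Y] (y : Y),
      PresentedByP p L F X x → PresentedByP p L G Y y → ∀ N : ℕ, Scheme.hsFun X N x = Scheme.hsFun Y N y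

/-- [OURS · row (E_p) DIRECTRIX] A point presented over a PERFECT field of characteristic `p` by `F` of order EXACTLY
`p` has `e = ē = ebar F`. (Row `Prop`; see `directrixRowP` for its discharge.) -/
def DirectrixRowP (p : ℕ) : Prop :=
  ∀ (L : Type) [Field L] [CharP L p] [PerfectField L] (F : MvPolynomial (Fin 4) L), ordZero F = (p : ℕ∞) →
    ∀ (X : Scheme.{0}) [IsLocallyNoetherian X] (x : X), PresentedByP p L F X x →
      Scheme.dirDim X x = ebar F ∧ Scheme.geomDirDim X x = ebar F

/-- [OURS · row (I_p) ISOLATION · OPEN for p ≠ 3 (res-dim4-p-11 g2)] A LOCAL scheme presented over a PERFECT field of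
characteristic `p` by `F` of order EXACTLY `p` with `IsIsolated p F` has its closed point isolated in its
Hilbert–Samuel locus at every level `N ≥ 5 = dim + 1`.  NOT proved here for general `p`. -/
def IsolationRowP (p : ℕ) : Prop :=
  ∀ (L : Type) [Field L] [CharP L p] [PerfectField L] (F : MvPolynomial (Fin 4) L), ordZero F = (p : ℕ∞) →
    IsIsolated p F → ∀ (S : Scheme.{0}) [IsLocallyNoetherian S] (s : S), IsLocalAt S s → PresentedByP p L F S s →
      ∀ N : ℕ, 5 ≤ N → IsIsolatedInHSMaxLocus S N s

/-- [OURS · row (X_p) SETTING · OPEN for p ≠ 3 (res-dim4-p-2 g2)] A LOCAL scheme presented over a PERFECT field of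
characteristic `p` by `F` of order EXACTLY `p` is excellent, of dimension `≤ 5`, satisfies (F1) `CharHypothesis`
(«char ≥ dim/2 + 1»: for our 4-folds exactly `p ≥ 3` — the ONE place the p-program needs `p ≠ 2`), and its closed
point is a permissible centre.  NOT proved here for general `p`. -/
def SettingRowP (p : ℕ) : Prop :=
  ∀ (L : Type) [Field L] [CharP L p] [PerfectField L] (F : MvPolynomial (Fin 4) L), ordZero F = (p : ℕ∞) →
    ∀ (S : Scheme.{0}) [IsLocallyNoetherian S] (s : S), IsLocalAt S s → PresentedByP p L F S s →
      ∀ hcl : IsClosed ({s} : Set S),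
        Scheme.IsExcellent S ∧ topologicalKrullDim ↥S ≤ (5 : WithBot ℕ∞) ∧ CharHypothesis S s ∧
          IdealSheafData.IsPermissible (vanishingIdeal (⟨{s}, hcl⟩ : Closeds S))

/-- [OURS · row (M_p) MODEL · OPEN for p ≠ 3 ((M-a_p)/(X_p) p-2 g2, (M-b_p) p-7 g2, (M-c_p) p-11 g2)] Over an
ALGEBRAICALLY CLOSED field `K` of characteristic `p`, every isolated `ē ≡ 2` floor chain of the frame at `q = p` has a
local hypersurface model presented node by node by the frame's own residual polynomials.  NOT proved here for
general `p`. -/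
def ModelRowP (p : ℕ) : Prop :=
  ∀ (K : Type) [Field K] [CharP K p] [IsAlgClosed K] [DecidableEq K] (c : ℕ → State K),
    (∀ k, IsIsolated p (c k).F ∧ Step0 p (c k) (c (k + 1)) ∧ ordZero (c k).F = (p : ℕ∞) ∧ ebar (c k).F = 2) →
    ∃ (S B : ℕ → Scheme.{0}) (_ : ∀ i, IsLocallyNoetherian (S i)) (_ : ∀ i, IsLocallyNoetherian (B i))
      (π : ∀ i, B i ⟶ S i) (pt : ∀ i, ↥(S i)) (b : ∀ i, ↥(B i)) (hcl : ∀ i, IsClosed ({pt i} : Set (S i))),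
      (∀ i, IsBlowup (π i) (vanishingIdeal ⟨{pt i}, hcl i⟩)) ∧ (∀ i, (π i).base (b i) = pt i) ∧
      (∀ i, IsClosed ({b i} : Set (B i))) ∧ (∀ i, IsLocalSchemeAt (S (i + 1)) (pt (i + 1)) (B i) (b i)) ∧
      (∀ i, IsLocalAt (S i) (pt i)) ∧
      (∀ i, PresentedByP p K (c i).F (S i) (pt i)) ∧ (∀ i, PresentedByP p K (c (i + 1)).F (B i) (b i))

/-- [OURS] **The transfer row at the prime `p` over ALGEBRAICALLY CLOSED fields** — exactly the hypothesis list of W4.2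
`LocalChains.false_of_units_chain`, existentially packaged, for isolated `ē ≡ 2` floor chains of the frame at `q = p`.
(Untagged parameterised `Prop`; not asserted.) -/
def IsolatedConeTwoChainLocalizesAlgClosedP (p : ℕ) : Prop :=
  ∀ (K : Type) [Field K] [CharP K p] [IsAlgClosed K] [DecidableEq K] (c : ℕ → State K),
    (∀ k, IsIsolated p (c k).F ∧ Step0 p (c k) (c (k + 1)) ∧ ordZero (c k).F = (p : ℕ∞) ∧ ebar (c k).F = 2) →
    ∃ (N : ℕ) (S B : ℕ → Scheme.{0}) (hS : ∀ i, IsLocallyNoetherian (S i)) (hB : ∀ i, IsLocallyNoetherian (B i))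
      (π : ∀ i, B i ⟶ S i) (pt : ∀ i, ↥(S i)) (b : ∀ i, ↥(B i)) (hcl : ∀ i, IsClosed ({pt i} : Set (S i))),
      (∀ i, IsBlowup (π i) (vanishingIdeal ⟨{pt i}, hcl i⟩)) ∧ (∀ i, (π i).base (b i) = pt i) ∧
      (∀ i, IsClosed ({b i} : Set (B i))) ∧
      (∀ i, Scheme.hsFun (B i) N (b i) = Scheme.hsFun (S i) N (pt i)) ∧
      (∀ i, IsLocalSchemeAt (S (i + 1)) (pt (i + 1)) (B i) (b i)) ∧ IsLocalAt (S 0) (pt 0) ∧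
      Scheme.IsExcellent (S 0) ∧ topologicalKrullDim ↥(S 0) ≤ (N : WithBot ℕ∞) ∧ CharHypothesis (S 0) (pt 0) ∧
      (∀ i, IdealSheafData.IsPermissible (vanishingIdeal (⟨{pt i}, hcl i⟩ : Closeds (S i)))) ∧
      (∀ i, @Scheme.dirDim (S i) (hS i) (pt i) = 2) ∧ (∀ i, @Scheme.geomDirDim (S i) (hS i) (pt i) = 2) ∧
      (∀ i, @Scheme.dirDim (B i) (hB i) (b i) = 2) ∧ (∀ i, @Scheme.geomDirDim (B i) (hB i) (b i) = 2) ∧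
      (∀ i, @IsIsolatedInHSMaxLocus (S i) (hS i) N (pt i))

/-! ## §3 The rows already discharged for every prime: (N_p) and (E_p) -/

/-- **ROW (N_p) HOLDS FOR EVERY PRIME `p`** — res-dim4-p-1 g2's `E2Near.hsFun_eq_of_stalk_iso_hypStalk` (p664524) is
stated for every prime: a multiplicity-`p` hypersurface point in regular `5`-space has ONE Hilbert–Samuel function
(perfectness of `L` is not even used). [OURS · row (N_p) ✓] [cite: CossartJannsenSaito2020, Lemma 2.27] -/
theorem nearRowP (p : ℕ) [Fact p.Prime] : NearRowP p := by
  intro L _ _ _ F G hF hG X _ x Y _ y hX hY N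
  obtain ⟨eX⟩ := hX
  obtain ⟨eY⟩ := hY
  exact E2Near.hsFun_eq_of_stalk_iso_hypStalk p F G hF hG x y eX eY N

/-- **ROW (E_p) HOLDS FOR EVERY PRIME `p`** — `E2Directrix.dirDim_eq_ebar_of_stalk_iso_hypStalk (p)` (p-1 g2's stalk half
∘ res-dim4-p-5 g2's `RidgeDirectrix.directrixDim_span_map_hyp_initialForm`, both p-generic): `e = ē = ebar F` for
every point presented by `𝒪_{𝔸⁵_L,0} ⧸ (z^p + F)`, `L` perfect, `ord₀ F = p`. [OURS · row (E_p) ✓]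
[cite: CossartJannsenSaito2020, Def. 2.18, Def. 2.21 and Def. 2.26] -/
theorem directrixRowP (p : ℕ) [Fact p.Prime] : DirectrixRowP p := by
  intro L _ _ _ F hF X _ x hX
  obtain ⟨eX⟩ := hX
  exact E2Directrix.dirDim_eq_ebar_of_stalk_iso_hypStalk p F hF x eX

/-- The p = 3 instances ARE the landed rows (sanity adapters). [OURS · adapter] [folklore] -/
theorem nearRow_of_nearRowP (h : NearRowP 3) : NearRow := by
  intro L _ _ _ F G hF hG X _ x Y _ y hX hY N
  exact h L F G (by exact_mod_cast hF) (by exact_mod_cast hG) X x Y y hX hY N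

/-- The p = 3 instances ARE the landed rows (sanity adapters). [OURS · adapter] [folklore] -/
theorem directrixRow_of_directrixRowP (h : DirectrixRowP 3) : DirectrixRow := by
  intro L _ _ _ F hF X _ x hX
  exact h L F (by exact_mod_cast hF) X x hX

/-- The p = 3 instances ARE the landed rows (sanity adapters). [OURS · adapter] [folklore] -/
theorem isolationRowP_three_of_isolationRow (h : IsolationRow) : IsolationRowP 3 := by
  intro L _ _ _ F hF hiso S _ s hloc hpres N hN
  exact h L F (by exact_mod_cast hF) hiso S s hloc hpres N hN

/-- The p = 3 instances ARE the landed rows (sanity adapters). [OURS · adapter] [folklore] -/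
theorem settingRowP_three_of_settingRow (h : SettingRow) : SettingRowP 3 := by
  intro L _ _ _ F hF S _ s hloc hpres hcl
  exact h L F (by exact_mod_cast hF) S s hloc hpres hcl

/-- The p = 3 instances ARE the landed rows (sanity adapters). [OURS · adapter] [folklore] -/
theorem modelRowP_three_of_modelRow (h : ModelRow) : ModelRowP 3 := by
  intro K _ _ _ _ c hc
  exact h K c fun k => ⟨(hc k).1, (hc k).2.1, by exact_mod_cast (hc k).2.2.1, (hc k).2.2.2⟩

/-! ## §4 The composition and the consumption of CJS Thm. 6.40 at a prime `p` -/

/-- **The five p-rows compose to the algebraically-closed transfer row at `p`** (bookkeeping; verbatim the p = 3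
composition `isolatedConeTwoChainLocalizesAlgClosed_of_rows` of res-dim4-p-2 g2 with `3 ↦ p`; level `N = 5`).
[OURS · glue] [folklore] -/
theorem isolatedConeTwoChainLocalizesAlgClosedP_of_rows (p : ℕ) (hM : ModelRowP p) (hN : NearRowP p)
    (hE : DirectrixRowP p) (hI : IsolationRowP p) (hX : SettingRowP p) :
    IsolatedConeTwoChainLocalizesAlgClosedP p := by
  intro K _ _ _ _ c hc
  haveI : PerfectField K := IsAlgClosed.perfectField K
  obtain ⟨S, B, hS, hB, π, pt, b, hcl, hπ, hb, hbcl, hS', hloc, hpS, hpB⟩ := hM K c hc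
  refine ⟨5, S, B, hS, hB, π, pt, b, hcl, hπ, hb, hbcl, ?_, hS', hloc 0, ?_, ?_, ?_, ?_, ?_, ?_, ?_, ?_, ?_⟩
  · intro i
    exact hN K (c (i + 1)).F (c i).F (hc (i + 1)).2.2.1 (hc i).2.2.1 (B i) (b i) (S i) (pt i) (hpB i) (hpS i) 5
  · exact (hX K (c 0).F (hc 0).2.2.1 (S 0) (pt 0) (hloc 0) (hpS 0) (hcl 0)).1
  · exact (hX K (c 0).F (hc 0).2.2.1 (S 0) (pt 0) (hloc 0) (hpS 0) (hcl 0)).2.1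
  · exact (hX K (c 0).F (hc 0).2.2.1 (S 0) (pt 0) (hloc 0) (hpS 0) (hcl 0)).2.2.1
  · intro i
    exact (hX K (c i).F (hc i).2.2.1 (S i) (pt i) (hloc i) (hpS i) (hcl i)).2.2.2
  · intro i
    rw [(hE K (c i).F (hc i).2.2.1 (S i) (pt i) (hpS i)).1, (hc i).2.2.2]
  · intro i
    rw [(hE K (c i).F (hc i).2.2.1 (S i) (pt i) (hpS i)).2, (hc i).2.2.2]
  · intro i
    rw [(hE K (c (i + 1)).F (hc (i + 1)).2.2.1 (B i) (b i) (hpB i)).1, (hc (i + 1)).2.2.2]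
  · intro i
    rw [(hE K (c (i + 1)).F (hc (i + 1)).2.2.1 (B i) (b i) (hpB i)).2, (hc (i + 1)).2.2.2]
  · intro i
    exact hI K (c i).F (hc i).2.2.1 (hc i).1 (S i) (pt i) (hloc i) (hpS i) 5 le_rfl

/-- **CJS Thm. 6.40 forbids the `ē ≡ 2` isolated floor chains over algebraically closed fields of characteristic
`p`, GIVEN the transfer row at `p`** — W4.2's `LocalChains.false_of_units_chain` is dimension- and
characteristic-free; (F1) sits inside the row ((X_p)). [OURS · conditional] [cite: CossartJannsenSaito2020, Thm. 6.40] -/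
theorem no_coneTwo_chain_of_CJS_algClosedP (p : ℕ) (hK640 : KeyTheorem640_char_localized_isolated.{0})
    (hT : IsolatedConeTwoChainLocalizesAlgClosedP p) (K : Type) [Field K] [CharP K p] [IsAlgClosed K]
    [DecidableEq K] :
    ¬ ∃ c : ℕ → State K, ∀ k, IsIsolated p (c k).F ∧ Step0 p (c k) (c (k + 1)) ∧
      ordZero (c k).F = (p : ℕ∞) ∧ ebar (c k).F = 2 := by
  rintro ⟨c, hc⟩
  obtain ⟨N, S, B, hS, hB, π, pt, b, hcl, hπ, hb, hbcl, hH, hS', hloc, hexc, hdim, hchar, hperm, he, hē, heB,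
    hēB, hiso⟩ := hT K c hc
  exact @false_of_units_chain hK640 N S B hS hB π pt b hcl hπ hb hbcl hH hS' hloc hexc hdim hchar hperm he hē
    heB hēB hiso

/-- **The p-program's conditional of record**: for every prime `p`, CJS Thm. 6.40 (F-111) and the three OPEN
p-rows (M_p), (I_p), (X_p) — (N_p), (E_p) being theorems — forbid isolated `ē ≡ 2` floor chains over every
algebraically closed field of characteristic `p`. [OURS · conditional assembly] [cite: CossartJannsenSaito2020, Thm. 6.40] -/
theorem no_coneTwo_chain_of_CJS_rowsP (p : ℕ) [Fact p.Prime] (hK640 : KeyTheorem640_char_localized_isolated.{0})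
    (hM : ModelRowP p) (hI : IsolationRowP p) (hX : SettingRowP p) (K : Type) [Field K] [CharP K p]
    [IsAlgClosed K] [DecidableEq K] :
    ¬ ∃ c : ℕ → State K, ∀ k, IsIsolated p (c k).F ∧ Step0 p (c k) (c (k + 1)) ∧
      ordZero (c k).F = (p : ℕ∞) ∧ ebar (c k).F = 2 :=
  no_coneTwo_chain_of_CJS_algClosedP p hK640
    (isolatedConeTwoChainLocalizesAlgClosedP_of_rows p hM (nearRowP p) (directrixRowP p) hI hX) K

end E2OfCJS

end Summit.ResolutionOfSingularities.ResolutionOfSingularities.Theorems.PIDim4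

end
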